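import Summits.NavierStokesRegularity.NavierStokesRegularity.Theses.QuantisedSymmetry
import Summits.NavierStokesRegularity.NavierStokesRegularity.Theses.Blowup
import Summits.NavierStokesRegularity.NavierStokesRegularity.Theorems.QuantisedSymmetryPolyhedralTruncationBridge
import Summits.NavierStokesRegularity.NavierStokesRegularity.Theorems.QuantisedSymmetryPolyhedralDssProfileExistsDominatesBlowupProfile
import Summits.NavierStokesRegularity.NavierStokesRegularity.Theorems.QuantisedSymmetryPolyhedralDssProfileExistsStubPeriodWindow
import Summits.NavierStokesRegularity.NavierStokesRegularity.Theorems.PumpContinuationEulerProximatePumpTruncationBridgeTypeI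
import Summits.NavierStokesRegularity.NavierStokesRegularity.Theorems.SoloInformedClayDichotomy
import Literature.Analysis.FluidPDE.SelfSimilarLiouville
import HarnessLib

/-!
# Strategist companion (family `s`, seat s19-g13) for crux `PolyhedralDssProfileExists`
(stmt-NavierStokesRegularity-1404, route `QuantisedSymmetry`)

Kernel-checked core of the independent STRATEGY CENSUS `STRATEGY-CENSUS-s19.md`.
Nothing here is a new line or a stub: every `theorem` below is PROVED (no `sorry`) from landed
tree theorems, and every `def` is a typed census entry (a weaker intermediate, a strengthening,
or a decomposition piece) whose fate is explained in the census.

Sections: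
* §1  the crux ALONE decides the summit (`crux_decides`, `crux_gives_breakdown`);
* §2  the weaker-intermediate ladder crux ⇒ W1 (Tsai's Type-I DSS Liouville conjecture fails)
      ⇒ W2 (`BlowupExists`, Type-I rate) ⇒ ¬(A): every station still decides the summit by
      landed theorems (`W1_decides`, `W2_decides`), so no station is "short of the summit";
* §3  strengthenings S⁺1 (continuous self-similar polyhedral profile) and S⁺2 (factors
      arbitrarily close to 1 at fixed Type-I constant): S⁺1 ⇒ crux trivially but is the
      NRŠ/Tsai-excluded class; S⁺2 is REFUTED in the tree (`not_smallFactorProfileExists`,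
      from the landed `stub_periodWindow` = Chae–Wolf 2017 Thm 1.3);
* §4  the best typed decomposition D-A (certified approximate cell ∧ abstract quadratic
      Newton–Kantorovich ⇒ crux) with its assembly PROVED (`decompositionDA_assembly`); the
      census explains why piece A is the crux again (no candidate, nondegeneracy unknown);
* §5  the strictly weaker NON-closing statements (drop DSS / drop Type-I) for the record.
-/

noncomputable section

open MeasureTheory Set Filter
open Literature.Analysis.FluidPDE

-- the nested summit namespace is the tree's layout (D-0017)
set_option linter.dupNamespace false

namespace Summit.NavierStokesRegularity.NavierStokesRegularity.Cruxes.PolyhedralDssProfileExists.S19g13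

/-- Shorthands (local abbreviations only). -/
abbrev E3 := EuclideanSpace ℝ (Fin 3)

open Summit.NavierStokesRegularity.NavierStokesRegularity
open Summit.NavierStokesRegularity.NavierStokesRegularity.Theses

/-! ## §1 The crux alone decides the summit -/

/-- **X⁻ ⊢ ¬(A).** The crux is the ONLY open load-bearing binder of the route's deciding theorem:
the other two binders are landed (`quantisedSymmetry_polyhedralTruncationBridge_proof`,
`ClayUniqueness_holds`). [tree] -/
theorem crux_decides (hX : QuantisedSymmetry.PolyhedralDssProfileExists) :
    ¬ _root_.NavierStokesRegularity :=
  QuantisedSymmetry.closes hX Theorems.quantisedSymmetry_polyhedralTruncationBridge_proof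
    QuantisedSymmetry.ClayUniqueness_holds

/-- **X⁻ ⊢ (C).** With the landed Clay dichotomy `(A) ∨ (C)` the crux proves Fefferman's (C) —
itself a Millennium statement (board rule: ¬(A) and (C) ARE the summit). [tree] -/
theorem crux_gives_breakdown (hX : QuantisedSymmetry.PolyhedralDssProfileExists) :
    NavierStokesBreakdownR3 :=
  (Theorems.navierStokesRegularity_or_breakdownR3).resolve_left (crux_decides hX)

/-! ## §2 The weaker-intermediate ladder: every station still decides the summit -/

/-- **X⁻ ⇒ W1** (drop the group: Tsai's Type-I (R)DSS Liouville conjecture fails;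
W1 = `Blowup.BlowupTypeIDssProfile`, stmt-NavierStokesRegularity-0155, OPEN). Landed as
`stub_dominatesBlowupProfile`. [tree] -/
theorem crux_imp_W1 (hX : QuantisedSymmetry.PolyhedralDssProfileExists) :
    Blowup.BlowupTypeIDssProfile :=
  Theorems.PolyhedralDssProfileExists.PolyhedralCell.stub_dominatesBlowupProfile hX

/-- **W1 ⇒ W2 with the Type-I rate** (W2 = `Blowup.BlowupExists`, X5a): the landed Type-I
truncation bridge `dssTruncationBridgeTypeI_proof` (its antecedent is literally W1). [tree] -/
theorem W1_imp_typeIBlowup (h : Blowup.BlowupTypeIDssProfile) :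
    ∃ ν : ℝ, 0 < ν ∧ ∃ T : ℝ, 0 < T ∧ ∃ (u : ℝ → E3 → E3) (p : ℝ → E3 → ℝ),
      IsMaximalSmoothSolution ν 0 u p T ∧ IsLerayHopfOn T ν 0 (u 0) u ∧
      HasRapidSpatialDecay (u 0) ∧ IsTypeIBlowup u T :=
  Theorems.dssTruncationBridgeTypeI_proof h

/-- **W1 ⇒ W2.** [tree] -/
theorem W1_imp_W2 (h : Blowup.BlowupTypeIDssProfile) : Blowup.BlowupExists := by
  obtain ⟨ν, hν, T, hT, u, p, hmax, hLH, hdec, -⟩ := W1_imp_typeIBlowup h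
  exact ⟨ν, hν, T, hT, u, p, hmax, hLH, hdec⟩

/-- **W2 ⊢ ¬(A)** (route `Blowup`'s deciding theorem with its landed uniqueness binder). [tree] -/
theorem W2_decides (h : Blowup.BlowupExists) : ¬ _root_.NavierStokesRegularity :=
  Blowup.closes h Blowup.BlowupClayUniqueness_holds

/-- **W1 ⊢ ¬(A).** So the weakest named intermediate below the crux on this line — the bare
negation of Tsai's conjecture, with no group and no rotation bookkeeping — already decides the
summit by landed theorems: it is not "short of the summit". [tree] -/
theorem W1_decides (h : Blowup.BlowupTypeIDssProfile) : ¬ _root_.NavierStokesRegularity :=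
  W2_decides (W1_imp_W2 h)

/-! ## §3 Strengthenings -/

/-- **S⁺1** (continuous self-similar polyhedral Type-I profile): the crux with `λ`-DSS replaced by
full scale invariance. Implies the crux (take `λ = 2`), but lies in the NRŠ 1996 / Tsai 1998
excluded class (`Literature.Analysis.FluidPDE.tsai_selfsimilar_holds`, barrier
`LeraySelfSimilarBlowupExclusion`): a Type-I self-similar ancient mild solution has a bounded
profile `U ∈ L^q`, `q > 3`, hence vanishes. Typed for the census; not pursued. -/
def SelfSimilarPolyhedralProfileExists : Prop :=
  ∃ G : Subgroup (E3 ≃ₗᵢ[ℝ] E3), Finite G ∧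
    (∀ g ∈ G, LinearMap.det (g.toLinearEquiv : E3 →ₗ[ℝ] E3) = 1) ∧
    (∀ V : Submodule ℝ E3, (∀ g ∈ G, ∀ v ∈ V, g v ∈ V) → V = ⊥ ∨ V = ⊤) ∧
    ∃ u : ℝ → E3 → E3, IsAncientMildSolution 1 u ∧ (∀ t < 0, AEStronglyMeasurable (u t) volume) ∧
      IsSelfSimilar u ∧ (∃ C₀ : ℝ, HasTypeIDecay C₀ u) ∧
      (∀ g ∈ G, ∀ t x, u t (g x) = g (u t x)) ∧ ¬ (∀ t < 0, u t =ᵐ[volume] 0)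

/-- **S⁺1 ⇒ X⁻** (a self-similar field is `2`-DSS). [folklore] -/
theorem crux_of_selfSimilar (h : SelfSimilarPolyhedralProfileExists) :
    QuantisedSymmetry.PolyhedralDssProfileExists := by
  obtain ⟨G, hfin, hdet, hirr, u, hanc, hmeas, hss, hdec, heqv, hnt⟩ := h
  exact ⟨G, hfin, hdet, hirr, 2, by norm_num, u, hanc, hmeas,
    hss.isDiscretelySelfSimilar (by norm_num), hdec, heqv, hnt⟩

/-- **S⁺2** (profiles with factor arbitrarily close to `1` at a FIXED Type-I constant): for some
`C₀ > 0` and every `c₁ > 1` there is a nontrivial Type-I (`C₀`) ancient mild `c`-DSS solution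
with `1 < c < c₁`. (No group clause: the refutation does not need it.) -/
def SmallFactorProfileExists : Prop :=
  ∃ C₀ : ℝ, 0 < C₀ ∧ ∀ c₁ : ℝ, 1 < c₁ →
    ∃ (c : ℝ) (u : ℝ → E3 → E3), 1 < c ∧ c < c₁ ∧ IsAncientMildSolution 1 u ∧
      (∀ t < 0, AEStronglyMeasurable (u t) volume) ∧ IsDiscretelySelfSimilar c u ∧
      HasTypeIDecay C₀ u ∧ ¬ (∀ t < 0, u t =ᵐ[volume] 0)

/-- **¬ S⁺2** from the landed period window `stub_periodWindow` (Chae–Wolf 2017, Thm 1.3, on the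
crux's own variables): the strengthening towards `λ → 1⁺` is refuted in the tree. [tree] -/
theorem not_smallFactorProfileExists : ¬ SmallFactorProfileExists := by
  rintro ⟨C₀, hC₀, h⟩
  obtain ⟨c₁, hc₁, hkill⟩ :=
    Theorems.PolyhedralDssProfileExists.PolyhedralCell.stub_periodWindow C₀ hC₀
  obtain ⟨c, u, hc, hcc₁, hanc, hmeas, hdss, hdec, hnt⟩ := h c₁ hc₁
  exact hnt (hkill c u hc hcc₁ hanc hmeas hdss hdec)

/-! ## §4 Decomposition D-A: certified approximate cell ∧ quadratic Newton–Kantorovich ⇒ X⁻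

The only split whose assembly is a theorem and whose easy half is genuinely easy. Piece B is pure
functional analysis (provable from Banach's fixed-point theorem; typed, not proved here — it is
not where the difficulty is). Piece A posits a Banach space `E` (a weighted space of
`G`-equivariant, divergence-free, `s`-periodic similarity profiles enforcing the `(1+|y|)⁻¹`
weight), the quadratic cell map `B` (Duhamel over one period / the Leray fixed-point map), a
CANDIDATE `V` with certified residual `ε`, a certified bounded inverse `Linv` of the linearisation
`I - B(V,·) - B(·,V)` (nondegeneracy of the orbit modulo the symmetry already quotiented by the
irreducible sector), the contraction inequality, the separation `‖V‖ > 2Mε` (so the exact fixed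
point is nonzero), and the DICTIONARY `realises` (a nonzero exact fixed point of the cell map is a
polyhedral Type-I DSS profile — the abstract form of the landed `stub_cellConcatenatesToDss`).
The census records why piece A is the crux again: no candidate `V` exists (no 3-D hunt has been
run; the polyhedral sector gives no dimension reduction), and certified invertibility of the
linearised period map at a large-amplitude orbit is exactly the nondegeneracy nobody can access. -/

/-- **Piece B (abstract quadratic Newton–Kantorovich).** If `V` is an `ε`-approximate fixed point
of the bounded quadratic map `w ↦ B w w`, the linearisation `w ↦ w - B V w - B w V` has a bounded
inverse `Linv` of norm `≤ M`, and `8 M² ‖B‖ ε < 1`, then an exact fixed point exists within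
`2 M ε` of `V`. [folklore] -/
def QuadraticNewtonKantorovich : Prop :=
  ∀ (E : Type) [NormedAddCommGroup E] [NormedSpace ℝ E] [CompleteSpace E]
    (B : E →L[ℝ] E →L[ℝ] E) (Linv : E →L[ℝ] E) (V : E) (M ε : ℝ),
    0 ≤ M → 0 ≤ ε →
    (∀ w : E, Linv (w - B V w - B w V) = w) →
    (∀ w : E, Linv w - B V (Linv w) - B (Linv w) V = w) →
    ‖Linv‖ ≤ M → ‖V - B V V‖ ≤ ε → 8 * M ^ 2 * ‖B‖ * ε < 1 →
    ∃ W : E, W = B W W ∧ ‖W - V‖ ≤ 2 * M * ε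

/-- **Piece A (certified approximate nondegenerate polyhedral cell).** See the section docstring;
`realises` is the cell ↔ crux dictionary. This is where ALL the difficulty sits. -/
def CertifiedPolyhedralCell : Prop :=
  ∃ (E : Type) (_ : NormedAddCommGroup E) (_ : NormedSpace ℝ E) (_ : CompleteSpace E)
    (B : E →L[ℝ] E →L[ℝ] E) (Linv : E →L[ℝ] E) (V : E) (M ε : ℝ),
    0 ≤ M ∧ 0 ≤ ε ∧
    (∀ w : E, Linv (w - B V w - B w V) = w) ∧
    (∀ w : E, Linv w - B V (Linv w) - B (Linv w) V = w) ∧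
    ‖Linv‖ ≤ M ∧ ‖V - B V V‖ ≤ ε ∧ 8 * M ^ 2 * ‖B‖ * ε < 1 ∧ 2 * M * ε < ‖V‖ ∧
    (∀ W : E, W = B W W → W ≠ 0 → QuantisedSymmetry.PolyhedralDssProfileExists)

/-- **Assembly of D-A, PROVED**: piece A ∧ piece B ⇒ X⁻ (the exact fixed point is nonzero by the
separation clause, and the dictionary turns it into the profile). [folklore] -/
theorem decompositionDA_assembly (hA : CertifiedPolyhedralCell) (hB : QuadraticNewtonKantorovich) :
    QuantisedSymmetry.PolyhedralDssProfileExists := by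
  obtain ⟨E, _, _, _, B, Linv, V, M, ε, hM, hε, hl, hr, hn, hres, hcon, hsep, hreal⟩ := hA
  obtain ⟨W, hW, hWV⟩ := hB E B Linv V M ε hM hε hl hr hn hres hcon
  refine hreal W hW ?_
  rintro rfl
  have hle : ‖V‖ ≤ 2 * M * ε := by simpa using hWV
  exact absurd hsep (not_lt.mpr hle)

/-! ## §5 Strictly weaker, NON-closing statements (for the record)

Dropping DSS (keep Type-I + `G`): a nontrivial `G`-equivariant Type-I ancient mild solution —
after the unit time-shift this is the negation of the route's kill switch `PolyhedralTypeILiouville`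
(stmt-1405), an open Liouville NEGATION with no construction mechanism and no bridge to (A)/(C)
(a bounded ancient solution truncates to nothing singular). Dropping Type-I (keep DSS + `G`):
junk-true — `u(t,x) = (-t)^{-k/2} ∇φ(x)` with `φ` a `G`-invariant homogeneous harmonic polynomial
(tetrahedral `y₁y₂y₃`, octahedral `x⁴+y⁴+z⁴-(3/5)r⁴`, icosahedral degree 6) is an exact smooth
`G`-equivariant self-similar (hence DSS) potential NS solution on `ℝ³ × (-∞,0)`, nontrivial, NOT
Type-I and not mild in the duality class for lack of decay. Typed below: the first one. -/

/-- **W⁰ (drop DSS): a nontrivial polyhedral Type-I ancient mild solution exists.** Strictly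
weaker than the crux (`crux_imp_W0`); does not decide the summit; its negation is (up to the unit
time-shift) the route's open kill switch stmt-NavierStokesRegularity-1405. -/
def NontrivialPolyhedralTypeIAncient : Prop :=
  ∃ G : Subgroup (E3 ≃ₗᵢ[ℝ] E3), Finite G ∧
    (∀ g ∈ G, LinearMap.det (g.toLinearEquiv : E3 →ₗ[ℝ] E3) = 1) ∧
    (∀ V : Submodule ℝ E3, (∀ g ∈ G, ∀ v ∈ V, g v ∈ V) → V = ⊥ ∨ V = ⊤) ∧
    ∃ u : ℝ → E3 → E3, IsAncientMildSolution 1 u ∧ (∀ t < 0, AEStronglyMeasurable (u t) volume) ∧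
      (∃ C₀ : ℝ, HasTypeIDecay C₀ u) ∧
      (∀ g ∈ G, ∀ t x, u t (g x) = g (u t x)) ∧ ¬ (∀ t < 0, u t =ᵐ[volume] 0)

/-- **X⁻ ⇒ W⁰** (forget the DSS clause). [folklore] -/
theorem crux_imp_W0 (hX : QuantisedSymmetry.PolyhedralDssProfileExists) :
    NontrivialPolyhedralTypeIAncient := by
  obtain ⟨G, hfin, hdet, hirr, c, -, u, hanc, hmeas, -, hdec, heqv, hnt⟩ := hX
  exact ⟨G, hfin, hdet, hirr, u, hanc, hmeas, hdec, heqv, hnt⟩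

end Summit.NavierStokesRegularity.NavierStokesRegularity.Cruxes.PolyhedralDssProfileExists.S19g13

end
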